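import Summits.Ventures.HodgeRepro2.T5SU11KernelDerivative
import Summits.Ventures.HodgeRepro2.T5SU11ResolventWeightedBasis
import Summits.Ventures.HodgeRepro2.T5SU11SphericalLpSharp

/-!
# The two-sided ground-state bound of the kernel: `|K_λ(t, s)| ≤ C_a Ξ(t) Ξ(s)` for `max(t, s) ≥ a > 0`

The kernel `K_λ(t, s) = −φ_λ(min(t, s)) χ_λ(max(t, s))` is bounded by the product of the ground states `Ξ = φ_1` at the two
points, uniformly away from the corner `t = s = 0`: the global bounds `φ_λ(t) ≤ c₁ e^{(λ−2)t}` (`t ≥ 0`, row 5xx),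
`χ_λ(s) ≤ c e^{−λs}` (`s ≥ a`, from row 5xx's bound on `[1, ∞)` and the maximum of `χ_λ` on `[a, 1]`) and the lower bound
`e^{−t} ≤ Ξ(t)` (Laplace's integral, row 3xx) give, for `min(t, s) ≤ max(t, s)`,
`φ_λ(min) χ_λ(max) ≤ c₁ c e^{(λ−2) min − λ max} = c₁ c e^{−t−s} e^{−(λ−1)(max − min)} ≤ c₁ c Ξ(t) Ξ(s)`.

* `exp_neg_le_sph_one` — `e^{−t} ≤ Ξ(t)` for `t ≥ 0`;
* `exists_sphDecay_le_exp_of_le` — **`χ_λ(s) ≤ c e^{−λs}` on `[a, ∞)`** for every `a > 0`;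
* `exists_abs_kernel_le_exp`, `exists_abs_kernel_le_mul_sph_one` — **`|K_λ(t, s)| ≤ C e^{−(t+s)} ≤ C Ξ(t) Ξ(s)`** for `t > 0`, `s ≥ a`;
* `exists_abs_kernel_le_mul_sph_one_of_le_max` — the same on `{max(t, s) ≥ a}` (symmetry of the kernel);
* `exists_kernel_source_le_mul_sph_one_uniform` — **the kernel sources `K_λ(·, s)`, `s ≥ a`, lie in `W_1` with the UNIFORM
  constant `C Ξ(s) ≤ C`** (row 575 gave a constant depending on `s`).

The restriction `max(t, s) ≥ a` is necessary: `χ_λ(s) = φ_λ(s) ∫_s^∞ du/(sinh 2u φ_λ(u)²)` has the logarithmic singularity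
`∼ ½ log(1/s)` of the hyperbolic plane's Green's function as `s → 0`, while `Ξ ≤ 1`, so no bound `C Ξ(t) Ξ(s)` holds near the
corner. Nothing is claimed about (N).

Blind lane: Mathlib + the HodgeRepro2 prefix only; no sorry; axioms ⊆ {propext, Classical.choice,
Quot.sound}.
-/

namespace Summit.Ventures.HodgeRepro2.T5SU11KernelTwoSidedBound

open Filter Topology MeasureTheory
open Set (Ioi Ioc Icc)
open T5SU11Cartan T5SU11SphericalFunction T5SU11SphericalBounds T5SU11SphericalDecay T5SU11RadialGreenKernel
  T5SU11ResolventWeightedBasis T5SU11SphericalLpSharp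

section measure

variable [MeasurableSpace Circle] [BorelSpace Circle]

/-- **`e^{−t} ≤ Ξ(t)`** for `t ≥ 0`: the ground state dominates the exponential `e^{−ρ t}`, `ρ = 1`. -/
theorem exp_neg_le_sph_one {t : ℝ} (ht : 0 ≤ t) : Real.exp (-t) ≤ sph 1 (hyp t) := by
  have h := exp_neg_mul_le_sph_hyp (lam := 1) zero_le_one ht
  simpa only [one_mul] using h

variable {lam : ℝ} (hlam : 1 < lam)

include hlam in
/-- **`χ_λ(s) ≤ c e^{−λs}` for all `s ≥ a`**, for every `a > 0` (the bound on `[1, ∞)` and the maximum of `χ_λ` on `[a, 1]`). -/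
theorem exists_sphDecay_le_exp_of_le {a : ℝ} (ha : 0 < a) :
    ∃ c : ℝ, 0 < c ∧ ∀ s, a ≤ s → sphDecay lam s ≤ c * Real.exp (-lam * s) := by
  obtain ⟨c₂, hc₂, hc₂'⟩ := exists_sphDecay_le_exp hlam
  have hsub : Icc a (max a 1) ⊆ Ioi 0 := fun s hs => lt_of_lt_of_le ha hs.1
  obtain ⟨s₁, hs₁, hmax⟩ := isCompact_Icc.exists_isMaxOn (Set.nonempty_Icc.mpr (le_max_left a 1))
    ((continuousOn_sphDecay hlam).mono hsub)
  have hχ : 0 < sphDecay lam s₁ := sphDecay_pos hlam (hsub hs₁)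
  refine ⟨max c₂ (sphDecay lam s₁ * Real.exp (lam * max a 1)), lt_max_of_lt_left hc₂, fun s hs => ?_⟩
  rcases le_or_gt 1 s with h1 | h1
  · calc sphDecay lam s ≤ c₂ * Real.exp (-lam * s) := hc₂' s h1
      _ ≤ max c₂ (sphDecay lam s₁ * Real.exp (lam * max a 1)) * Real.exp (-lam * s) :=
          mul_le_mul_of_nonneg_right (le_max_left _ _) (Real.exp_pos _).le
  · have hs' : s ∈ Icc a (max a 1) := ⟨hs, le_trans h1.le (le_max_right a 1)⟩
    have hle : sphDecay lam s ≤ sphDecay lam s₁ := (isMaxOn_iff.mp hmax) s hs'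
    have hsm : s ≤ max a 1 := hs'.2
    calc sphDecay lam s ≤ sphDecay lam s₁ := hle
      _ = sphDecay lam s₁ * Real.exp (lam * max a 1) * Real.exp (-lam * max a 1) := by
          rw [mul_assoc, ← Real.exp_add]
          simp
      _ ≤ sphDecay lam s₁ * Real.exp (lam * max a 1) * Real.exp (-lam * s) := by
          apply mul_le_mul_of_nonneg_left _ (mul_nonneg hχ.le (Real.exp_pos _).le)
          apply Real.exp_le_exp.mpr
          nlinarith
      _ ≤ max c₂ (sphDecay lam s₁ * Real.exp (lam * max a 1)) * Real.exp (-lam * s) :=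
          mul_le_mul_of_nonneg_right (le_max_right _ _) (Real.exp_pos _).le

include hlam in
/-- `|K_λ(t, s)| = φ_λ(min(t, s)) χ_λ(max(t, s))` for `t > 0`. -/
theorem abs_sphGreenKernel_eq {t s : ℝ} (ht : 0 < t) :
    |sphGreenKernel lam t s| = sph lam (hyp (min t s)) * sphDecay lam (max t s) := by
  have hmax : 0 < max t s := lt_max_of_lt_left ht
  unfold sphGreenKernel greenKernel
  rw [abs_neg, abs_of_pos (mul_pos (sph_hyp_pos lam _) (sphDecay_pos hlam hmax))]

include hlam in
/-- **`|K_λ(t, s)| ≤ C e^{−(t+s)}` for `t > 0` and `s ≥ a`**, for every `a > 0`. -/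
theorem exists_abs_kernel_le_exp {a : ℝ} (ha : 0 < a) :
    ∃ C : ℝ, 0 < C ∧ ∀ t s, 0 < t → a ≤ s → |sphGreenKernel lam t s| ≤ C * Real.exp (-(t + s)) := by
  obtain ⟨c₁, hc₁, hc₁'⟩ := exists_sph_hyp_le_exp hlam
  obtain ⟨c, hc, hc'⟩ := exists_sphDecay_le_exp_of_le hlam ha
  refine ⟨c₁ * c, mul_pos hc₁ hc, fun t s ht hs => ?_⟩
  have hs0 : 0 < s := lt_of_lt_of_le ha hs
  rw [abs_sphGreenKernel_eq hlam ht]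
  have hφ : 0 ≤ sph lam (hyp (min t s)) := (sph_hyp_pos lam _).le
  rcases le_total t s with hts | hst
  · rw [min_eq_left hts, max_eq_right hts]
    calc sph lam (hyp t) * sphDecay lam s ≤ (c₁ * Real.exp ((lam - 2) * t)) * (c * Real.exp (-lam * s)) :=
          mul_le_mul (hc₁' t ht.le) (hc' s hs) (sphDecay_pos hlam hs0).le (by positivity)
      _ = c₁ * c * Real.exp ((lam - 2) * t + -lam * s) := by
          rw [Real.exp_add]
          ring
      _ ≤ c₁ * c * Real.exp (-(t + s)) := by
          apply mul_le_mul_of_nonneg_left _ (mul_pos hc₁ hc).le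
          apply Real.exp_le_exp.mpr
          nlinarith
  · rw [min_eq_right hst, max_eq_left hst]
    have hta : a ≤ t := le_trans hs hst
    calc sph lam (hyp s) * sphDecay lam t ≤ (c₁ * Real.exp ((lam - 2) * s)) * (c * Real.exp (-lam * t)) :=
          mul_le_mul (hc₁' s hs0.le) (hc' t hta) (sphDecay_pos hlam ht).le (by positivity)
      _ = c₁ * c * Real.exp ((lam - 2) * s + -lam * t) := by
          rw [Real.exp_add]
          ring
      _ ≤ c₁ * c * Real.exp (-(t + s)) := by
          apply mul_le_mul_of_nonneg_left _ (mul_pos hc₁ hc).le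
          apply Real.exp_le_exp.mpr
          nlinarith

include hlam in
/-- **THE TWO-SIDED GROUND-STATE BOUND OF THE KERNEL**: `|K_λ(t, s)| ≤ C Ξ(t) Ξ(s)` for `t > 0` and `s ≥ a`, for every `a > 0`. -/
theorem exists_abs_kernel_le_mul_sph_one {a : ℝ} (ha : 0 < a) :
    ∃ C : ℝ, 0 < C ∧ ∀ t s, 0 < t → a ≤ s →
      |sphGreenKernel lam t s| ≤ C * (sph 1 (hyp t) * sph 1 (hyp s)) := by
  obtain ⟨C, hC, hC'⟩ := exists_abs_kernel_le_exp hlam ha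
  refine ⟨C, hC, fun t s ht hs => ?_⟩
  have hs0 : 0 < s := lt_of_lt_of_le ha hs
  calc |sphGreenKernel lam t s| ≤ C * Real.exp (-(t + s)) := hC' t s ht hs
    _ = C * (Real.exp (-t) * Real.exp (-s)) := by
        rw [← Real.exp_add]
        ring_nf
    _ ≤ C * (sph 1 (hyp t) * sph 1 (hyp s)) := by
        apply mul_le_mul_of_nonneg_left _ hC.le
        exact mul_le_mul (exp_neg_le_sph_one ht.le) (exp_neg_le_sph_one hs0.le) (Real.exp_pos _).le
          (sph_hyp_pos 1 t).le

include hlam in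
/-- The two-sided bound on the region `max(t, s) ≥ a` (by the symmetry of the kernel). -/
theorem exists_abs_kernel_le_mul_sph_one_of_le_max {a : ℝ} (ha : 0 < a) :
    ∃ C : ℝ, 0 < C ∧ ∀ t s, 0 < t → 0 < s → a ≤ max t s →
      |sphGreenKernel lam t s| ≤ C * (sph 1 (hyp t) * sph 1 (hyp s)) := by
  obtain ⟨C, hC, hC'⟩ := exists_abs_kernel_le_mul_sph_one hlam ha
  refine ⟨C, hC, fun t s ht hs hm => ?_⟩
  rcases le_total t s with hts | hst
  · rw [max_eq_right hts] at hm
    exact hC' t s ht hm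
  · rw [max_eq_left hst] at hm
    rw [sphGreenKernel_symm, mul_comm (sph 1 (hyp t))]
    exact hC' s t hs hm

include hlam in
/-- **The kernel sources `K_λ(·, s)`, `s ≥ a`, lie in `W_1` with the uniform constant `C Ξ(s)`**:
`|K_λ(r, s)| ≤ (C Ξ(s)) Ξ(r)` for all `r > 0` and `s ≥ a`. -/
theorem exists_kernel_source_le_mul_sph_one_uniform {a : ℝ} (ha : 0 < a) :
    ∃ C : ℝ, 0 < C ∧ ∀ s, a ≤ s → ∀ r, 0 < r →
      |sphGreenKernel lam r s| ≤ (C * sph 1 (hyp s)) * sph 1 (hyp r) := by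
  obtain ⟨C, hC, hC'⟩ := exists_abs_kernel_le_mul_sph_one hlam ha
  refine ⟨C, hC, fun s hs r hr => ?_⟩
  calc |sphGreenKernel lam r s| ≤ C * (sph 1 (hyp r) * sph 1 (hyp s)) := hC' r s hr hs
    _ = (C * sph 1 (hyp s)) * sph 1 (hyp r) := by ring

include hlam in
/-- The uniform constant is itself bounded: `|K_λ(r, s)| ≤ C Ξ(r)` for all `r > 0`, `s ≥ a` (`Ξ ≤ 1`). -/
theorem exists_kernel_source_le_mul_sph_one_uniform' {a : ℝ} (ha : 0 < a) :
    ∃ C : ℝ, 0 < C ∧ ∀ s, a ≤ s → ∀ r, 0 < r → |sphGreenKernel lam r s| ≤ C * sph 1 (hyp r) := by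
  obtain ⟨C, hC, hC'⟩ := exists_kernel_source_le_mul_sph_one_uniform hlam ha
  refine ⟨C, hC, fun s hs r hr => ?_⟩
  calc |sphGreenKernel lam r s| ≤ (C * sph 1 (hyp s)) * sph 1 (hyp r) := hC' s hs r hr
    _ ≤ (C * 1) * sph 1 (hyp r) := by
        apply mul_le_mul_of_nonneg_right _ (sph_hyp_pos 1 r).le
        exact mul_le_mul_of_nonneg_left (sph_hyp_le_one zero_le_one one_le_two s) hC.le
    _ = C * sph 1 (hyp r) := by ring

end measure

end Summit.Ventures.HodgeRepro2.T5SU11KernelTwoSidedBound
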